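import Mathlib
import HarnessLib
import Summits.HubbardSuperconductivity.HubbardSuperconductivity.Theorems.KLProgrammeKLRegimeEngineFlowLineDictionary
import Summits.HubbardSuperconductivity.HubbardSuperconductivity.Theorems.KLProgrammeKLRegimeEnginePairTransferDLineSupport

/-!
# Route `KLProgramme` — ENGINE item stmt-HubbardSuperconductivity-20437 `KLRegimeEngineV17F2`, class-#5 STEP (X).3 rows form:
# THE MEMBER PH ROW `hP` OF `klmd_defect_le_rows_family` IN THE LATTICE ROWS' FORM — partner collapse, the `k̃ ↦ k̃ − q̃` re-indexing of the
# mirrored term, the `(βL²)²·klfb_prop·klfb_prop` dictionary, and the deep-member substitution `Φ_j ↦ Φ_{n+2}` at small transfer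
# (cell gate-hubbard-kl, seat hubbard-kl-k3c2-p2 g17)

WHY.  The direct PH row `hP` of the class-#5 ξᵢ door (`klmd_defect_le_rows_family`, member `j`, class `Qm`, at `(t,x,y)`) is the SIGNED sum
`Σ_p Σ_σ Σ_{p′} 𝟙[ω_{p′} = ω_p, k′ = k + x − y]·(Φ_j(t)(p)G(p)·Ẇ(p′)G(p′) + Ẇ(p)G(p)·Φ_j(t)(p′)G(p′))·V(…p σ…p′ σ…)·V(…)`, `G = βL²·ĝ_K`.  The signed
lattice rows (`klfl_lattice_soft_bubble_norm_le_model`, …LatticeSoftBubbleModel) read `Σ_{i,k̃} a·Φ_f(ω_i, e_K(k̃))·Φ_{f′}(ω_i + q₀, e_K(k̃ + q̃))` with the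
SLICE weight `f` first.  This file rewrites the former into (twice) the latter:

* §1 `klrf_sum_ite_direct_eq` (partner collapse, any codomain), **`klrf_direct_sum_eq`** (generic weights `w₁ w₂`, line factor `G`, kernel `F`):
  `LHS = Σ_p ℓ_{w₂}(p)·ℓ_{w₁}(p⁺)·(Σ_σ F p σ p⁺) + Σ_p ℓ_{w₂}(p)·ℓ_{w₁}(p⁻)·(Σ_σ F p⁻ σ p)`, `p^± = (ω_p, k ± (x − y))` (the mirrored term re-indexed by
  `k̃ ↦ k̃ − q̃`, so the slice line sits at the summation label in BOTH terms);
* §2 **`klrf_direct_sum_eq_model`**: with `w₁ = Φ_j(t)`, `w₂ = Ẇ_{Λ(t)}`, `G = βL²·ĝ_K` the two terms are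
  `(βL²)²·Σ_{(i,k̃)} P^±(i,k̃)·klfb_prop (klWdC Λ(t)) ω_i (e_K k̃)·klfb_prop (klPhiC Λ_j Λ(t)) ω_i (e_K (k̃ ± q̃))` (`…FlowLineDictionary`), and
  `klrf_sum_freqMomentum_eq_smul` turns `Σ_{(i,k̃)}` into `β·L²·(β⁻¹•Σ_i (L²)⁻¹•Σ_k̃ …)` — the rows' normalisation;
* §3 **`klrf_direct_sum_member_eq_near`**: for a deep member `n + 2 ≤ j` at small transfer `G·|p_{x−y}|_𝕋 ≤ Λ(t)/6` the literal sum with `Φ_j(t)` EQUALS the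
  literal sum with `Φ_{n+2}(t)` (the difference is the `D`-line row of the pair `(j, n+2)`, whose factors vanish termwise: `direct_DLine_factors_eq_zero`) —
  so the partner weight of every member is `klPhiC Λ_m Λ(t)` with `m ∈ {n+1, n+2}` and O(1) Lipschitz data (`klfw_partner_hypotheses`).

Pure rewriting; nothing about the model's effective action is asserted; nothing asserts (X).3, (c), K3 or superconductivity.
-/

noncomputable section

namespace Summit.HubbardSuperconductivity.HubbardSuperconductivity.Theorems.KLRegimeSplit

set_option linter.dupNamespace false -- summit = problem name (single-conjunct summit), D-0017

open Real Set Finset Complex Literature.MathematicalPhysics.QuantumLattice Literature.Probability.LatticeModels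
open Summit.HubbardSuperconductivity.HubbardSuperconductivity.Theorems.KLProgrammeLegKernels
open Summit.HubbardSuperconductivity.HubbardSuperconductivity.Theorems.KLRegimeWick
open Summit.HubbardSuperconductivity.HubbardSuperconductivity.Theorems.TwoPointAssembly
open Summit.HubbardSuperconductivity.HubbardSuperconductivity.Theorems.DispersionFlow

variable {L M : ℕ} [NeZero L] [NeZero M]

/-! ## §1 Partner collapse and the re-indexed split (generic) -/

/-- **Partner collapse** (any additive codomain): the direct constraint `m_{p′} + m₀ = m_p + m₀ ∧ k′ = k + x − y` singles out `p′ = (ω_p, k + (x − y))`. -/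
theorem klrf_sum_ite_direct_eq {E : Type*} [AddCommMonoid E] (x y : TorusSite 2 L) (p : FreqMomentum L M) (Φ : FreqMomentum L M → E) :
    (∑ p' : FreqMomentum L M, if matsubaraInt M p'.1 + matsubaraInt M (omega0 M) = matsubaraInt M p.1 + matsubaraInt M (omega0 M) ∧ p'.2 = p.2 + x - y
      then Φ p' else 0) = Φ (p.1, p.2 + (x - y)) := by
  rw [Finset.sum_eq_single (p.1, p.2 + (x - y))]
  · simp [add_sub_assoc]
  · intro p' _ hne
    rw [if_neg]
    rintro ⟨h1, h2⟩
    apply hne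
    have h1' : p'.1 = p.1 := by
      have h3 : matsubaraInt M p'.1 = matsubaraInt M p.1 := by linarith
      simp only [matsubaraInt] at h3
      exact Fin.ext (by omega)
    exact Prod.ext h1' (by rw [h2, add_sub_assoc])
  · intro h; exact absurd (Finset.mem_univ _) h

omit [NeZero L] [NeZero M] in
/-- The momentum shift of a frequency–momentum label: `p⁺ = (ω_p, k + q̃)`. -/
theorem klrf_shift_shift (p : FreqMomentum L M) (q : TorusSite 2 L) : ((p.1, p.2 + -q).1, (p.1, p.2 + -q).2 + q) = p := by
  ext <;> simp

/-- **THE RE-INDEXED SPLIT** (generic): weights `w₁` (partner) and `w₂` (slice), line factor `G`, kernel `F`; lines `ℓ_w(p) = w(p)·G(p)`.  The literal direct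
row equals `Σ_p ℓ_{w₂}(p)ℓ_{w₁}(p⁺)(Σ_σ F p σ p⁺) + Σ_p ℓ_{w₂}(p)ℓ_{w₁}(p⁻)(Σ_σ F p⁻ σ p)`, `p^± = (ω_p, k ± (x − y))`. -/
theorem klrf_direct_sum_eq (w₁ w₂ : FreqMomentum L M → ℝ) (G : FreqMomentum L M → ℂ) (F : FreqMomentum L M → Fin 2 → FreqMomentum L M → ℂ)
    (x y : TorusSite 2 L) :
    (∑ p : FreqMomentum L M, ∑ σ : Fin 2, ∑ p' : FreqMomentum L M,
        if matsubaraInt M p'.1 + matsubaraInt M (omega0 M) = matsubaraInt M p.1 + matsubaraInt M (omega0 M) ∧ p'.2 = p.2 + x - y then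
          ((((w₁ p : ℝ)) : ℂ) * G p * ((((w₂ p' : ℝ)) : ℂ) * G p') + (((w₂ p : ℝ)) : ℂ) * G p * ((((w₁ p' : ℝ)) : ℂ) * G p')) * F p σ p'
        else 0) =
      (∑ p : FreqMomentum L M, (((w₂ p : ℝ)) : ℂ) * G p * ((((w₁ (p.1, p.2 + (x - y)) : ℝ)) : ℂ) * G (p.1, p.2 + (x - y))) *
          ∑ σ : Fin 2, F p σ (p.1, p.2 + (x - y))) +
      ∑ p : FreqMomentum L M, (((w₂ p : ℝ)) : ℂ) * G p * ((((w₁ (p.1, p.2 + -(x - y)) : ℝ)) : ℂ) * G (p.1, p.2 + -(x - y))) *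
          ∑ σ : Fin 2, F (p.1, p.2 + -(x - y)) σ p := by
  -- collapse the partner sum
  have hcol : ∀ (p : FreqMomentum L M) (σ : Fin 2),
      (∑ p' : FreqMomentum L M,
        if matsubaraInt M p'.1 + matsubaraInt M (omega0 M) = matsubaraInt M p.1 + matsubaraInt M (omega0 M) ∧ p'.2 = p.2 + x - y then
          ((((w₁ p : ℝ)) : ℂ) * G p * ((((w₂ p' : ℝ)) : ℂ) * G p') + (((w₂ p : ℝ)) : ℂ) * G p * ((((w₁ p' : ℝ)) : ℂ) * G p')) * F p σ p'
        else 0) =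
      ((((w₁ p : ℝ)) : ℂ) * G p * ((((w₂ (p.1, p.2 + (x - y)) : ℝ)) : ℂ) * G (p.1, p.2 + (x - y))) +
        (((w₂ p : ℝ)) : ℂ) * G p * ((((w₁ (p.1, p.2 + (x - y)) : ℝ)) : ℂ) * G (p.1, p.2 + (x - y)))) * F p σ (p.1, p.2 + (x - y)) :=
    fun p σ => klrf_sum_ite_direct_eq x y p _
  simp_rw [hcol, add_mul, Finset.sum_add_distrib, ← Finset.mul_sum]
  rw [add_comm]
  congr 1
  -- re-index the mirrored term by `k̃ ↦ k̃ − q̃`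
  set e : FreqMomentum L M ≃ FreqMomentum L M := Equiv.prodCongr (Equiv.refl _) (Equiv.addRight (-(x - y))) with he
  rw [← Equiv.sum_comp e]
  refine Finset.sum_congr rfl fun p _ => ?_
  have e1 : e p = (p.1, p.2 + -(x - y)) := rfl
  have e2 : ((e p).1, (e p).2 + (x - y)) = p := by rw [e1]; exact klrf_shift_shift p (x - y)
  rw [e2, e1]
  ring

/-! ## §2 The model lines and the rows' normalisation -/

omit [NeZero M] in
/-- `Σ_{(i,k̃)} Φ(i,k̃) = β·L²·(β⁻¹ • Σ_i (L²)⁻¹ • Σ_k̃ Φ(i,k̃))` (`β ≠ 0`). -/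
theorem klrf_sum_freqMomentum_eq_smul {β : ℝ} (hβ : β ≠ 0) (Φ : MatsubaraIdx M → TorusSite 2 L → ℂ) :
    (∑ p : FreqMomentum L M, Φ p.1 p.2) =
      (((β * (L : ℝ) ^ 2 : ℝ)) : ℂ) * (β⁻¹ • ∑ i : MatsubaraIdx M, ((L ^ 2 : ℕ) : ℝ)⁻¹ • ∑ k : TorusSite 2 L, Φ i k) := by
  have hL : ((L : ℝ)) ≠ 0 := by exact_mod_cast NeZero.ne L
  rw [Fintype.sum_prod_type, Finset.smul_sum]
  simp_rw [smul_smul]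
  rw [Finset.mul_sum]
  refine Finset.sum_congr rfl fun i _ => ?_
  rw [Complex.real_smul, ← mul_assoc]
  have e : (((β * (L : ℝ) ^ 2 : ℝ)) : ℂ) * (((β⁻¹ * ((L ^ 2 : ℕ) : ℝ)⁻¹ : ℝ)) : ℂ) = 1 := by
    rw [← Complex.ofReal_mul, ← Complex.ofReal_one]
    congr 1
    push_cast
    field_simp
  rw [e, one_mul]

variable (β μ : ℝ) (K : TrigPolyC4v)

omit [NeZero L] [NeZero M] in
/-- **THE MODEL LINES**: with `G = βL²·ĝ_K`, `w₂ = Ẇ_Λ` and `w₁ = Φ_j` (literal STEP forms) one product of lines is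
`(βL²)²·klfb_prop (klWdC Λ) ω_p (e_K k̃)·klfb_prop (klPhiC Λ_j Λ) ω_p (e_K k̃′)` for a partner label `p′ = (ω_p, k̃′)` with the SAME frequency. -/
theorem klrf_lines_eq {β : ℝ} (hβ : β ≠ 0) (n j : ℕ) {Λ : ℝ} (hΛ : Λ ≠ 0) (p : FreqMomentum L M) (k' : TorusSite 2 L) :
    (((deriv (fun Λ' : ℝ => hubbardCutoffWeightCT L M β μ K Λ' p) Λ : ℝ)) : ℂ) * ((((β * (L : ℝ) ^ 2 : ℝ)) : ℂ) * propCT L M β μ K p) *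
        ((((softSymbolCompl L M β μ K (n + 1) j (p.1, k') +
              (hubbardCutoffWeightCT L M β μ K (klScale klE0 (n + 1)) (p.1, k') - hubbardCutoffWeightCT L M β μ K Λ (p.1, k')) : ℝ)) : ℂ) *
          ((((β * (L : ℝ) ^ 2 : ℝ)) : ℂ) * propCT L M β μ K (p.1, k'))) =
      (((β * (L : ℝ) ^ 2 : ℝ)) : ℂ) ^ 2 *
        (klfb_prop (klWdC Λ) (matsubaraFreq β M p.1) (nambuXiCT L μ K p.2) *
          klfb_prop (klPhiC (klScale klE0 j) Λ) (matsubaraFreq β M p.1) (nambuXiCT L μ K k')) := by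
  rw [klfw_sliceLine_eq μ K hβ hΛ p, klfw_memberLine_eq μ K hβ n j Λ (p.1, k')]
  ring

/-- **THE DIRECT MEMBER ROW IN THE ROWS' FORM.**  For the literal weights of the STEP (`Φ`, `Wd` pinned by their defining equations, `Λ(t) ≠ 0`, `β ≠ 0`) and ANY
kernel `V`, the `hP` sum of `klmd_defect_le_rows_family` equals
`(βL²)²·[Σ_p P⁺(p)·Φ_{Ẇ}(ω_p, e_K k̃)·Φ_{Φ_j}(ω_p, e_K(k̃ + (x−y))) + Σ_p P⁻(p)·Φ_{Ẇ}(ω_p, e_K k̃)·Φ_{Φ_j}(ω_p, e_K(k̃ − (x−y)))]` with the kernel products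
`P⁺(p) = Σ_σ V(p σ 1, p⁺ σ 0, y, x)·V(p σ 0, p⁺ σ 1, Qm−y, Qm−x)` and `P⁻(p) = Σ_σ V(p⁻ σ 1, p σ 0, …)·V(p⁻ σ 0, p σ 1, …)`. -/
theorem klrf_direct_sum_eq_model {β : ℝ} (hβ : β ≠ 0) (n : ℕ) {t : ℝ} (hΛ : klScale klE0 n + t * (klScale klE0 (n + 1) - klScale klE0 n) ≠ 0)
    (Φ : ℕ → ℝ → FreqMomentum L M → ℝ) (hΦ : Φ = fun j t k => (softSymbolCompl L M β μ K (n + 1) j) k + (hubbardCutoffWeightCT L M β μ K (klScale klE0 (n + 1)) k -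
            hubbardCutoffWeightCT L M β μ K (klScale klE0 n + t * (klScale klE0 (n + 1) - klScale klE0 n)) k))
    (Wd : ℝ → FreqMomentum L M → ℝ) (hWd : Wd = fun t k => deriv (fun Λ' : ℝ => hubbardCutoffWeightCT L M β μ K Λ' k) (klScale klE0 n + t * (klScale klE0 (n + 1) - klScale klE0 n)))
    (V : ℕ → ℝ → (Fin 4 → HubbardFieldIdx L M) → ℂ) (j : ℕ) (Qm x y : TorusSite 2 L) :
    (∑ p : FreqMomentum L M, ∑ σ : Fin 2, ∑ p' : FreqMomentum L M,
        if matsubaraInt M p'.1 + matsubaraInt M (omega0 M) = matsubaraInt M p.1 + matsubaraInt M (omega0 M) ∧ p'.2 = p.2 + x - y then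
          ((((((Φ j t p) : ℝ) : ℂ) * (((β * (L : ℝ) ^ 2 : ℝ) : ℂ) * propCT L M β μ K p)) * ((((Wd t p') : ℝ) : ℂ) * (((β * (L : ℝ) ^ 2 : ℝ) : ℂ) * propCT L M β μ K p'))) +
              (((((Wd t p) : ℝ) : ℂ) * (((β * (L : ℝ) ^ 2 : ℝ) : ℂ) * propCT L M β μ K p)) * ((((Φ j t p') : ℝ) : ℂ) * (((β * (L : ℝ) ^ 2 : ℝ) : ℂ) * propCT L M β μ K p')))) *
            (V j t ![((p, σ), 1), ((p', σ), 0), (((omega0 M, y), 0), 0), (((omega0 M, x), 0), 1)] *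
              V j t ![((p, σ), 0), ((p', σ), 1), ((((omega0 M).rev, Qm - y), 1), 0), ((((omega0 M).rev, Qm - x), 1), 1)])
        else 0) =
      (((β * (L : ℝ) ^ 2 : ℝ)) : ℂ) ^ 2 *
        ((∑ p : FreqMomentum L M,
            (∑ σ : Fin 2, V j t ![((p, σ), 1), (((p.1, p.2 + (x - y)), σ), 0), (((omega0 M, y), 0), 0), (((omega0 M, x), 0), 1)] *
                V j t ![((p, σ), 0), (((p.1, p.2 + (x - y)), σ), 1), ((((omega0 M).rev, Qm - y), 1), 0), ((((omega0 M).rev, Qm - x), 1), 1)]) *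
              (klfb_prop (klWdC (klScale klE0 n + t * (klScale klE0 (n + 1) - klScale klE0 n))) (matsubaraFreq β M p.1) (nambuXiCT L μ K p.2) *
                klfb_prop (klPhiC (klScale klE0 j) (klScale klE0 n + t * (klScale klE0 (n + 1) - klScale klE0 n))) (matsubaraFreq β M p.1)
                  (nambuXiCT L μ K (p.2 + (x - y))))) +
          ∑ p : FreqMomentum L M,
            (∑ σ : Fin 2, V j t ![(((p.1, p.2 + -(x - y)), σ), 1), ((p, σ), 0), (((omega0 M, y), 0), 0), (((omega0 M, x), 0), 1)] *
                V j t ![(((p.1, p.2 + -(x - y)), σ), 0), ((p, σ), 1), ((((omega0 M).rev, Qm - y), 1), 0), ((((omega0 M).rev, Qm - x), 1), 1)]) *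
              (klfb_prop (klWdC (klScale klE0 n + t * (klScale klE0 (n + 1) - klScale klE0 n))) (matsubaraFreq β M p.1) (nambuXiCT L μ K p.2) *
                klfb_prop (klPhiC (klScale klE0 j) (klScale klE0 n + t * (klScale klE0 (n + 1) - klScale klE0 n))) (matsubaraFreq β M p.1)
                  (nambuXiCT L μ K (p.2 + -(x - y))))) := by
  have h := klrf_direct_sum_eq (Φ j t) (Wd t) (fun p => (((β * (L : ℝ) ^ 2 : ℝ)) : ℂ) * propCT L M β μ K p)
    (fun p σ p' => V j t ![((p, σ), 1), ((p', σ), 0), (((omega0 M, y), 0), 0), (((omega0 M, x), 0), 1)] *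
      V j t ![((p, σ), 0), ((p', σ), 1), ((((omega0 M).rev, Qm - y), 1), 0), ((((omega0 M).rev, Qm - x), 1), 1)]) x y
  rw [h, mul_add, Finset.mul_sum, Finset.mul_sum]
  subst hΦ hWd
  congr 1
  · refine Finset.sum_congr rfl fun p _ => ?_
    rw [klrf_lines_eq μ K hβ n j hΛ p (p.2 + (x - y))]
    ring
  · refine Finset.sum_congr rfl fun p _ => ?_
    rw [klrf_lines_eq μ K hβ n j hΛ p (p.2 + -(x - y))]
    ring

/-! ## §3 The deep-member substitution `Φ_j ↦ Φ_{n+2}` at small transfer -/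

/-- **DEEP MEMBER ⟹ NEAR PARTNER.**  For an admissible frame, `n + 2 ≤ j`, `t ∈ [0,1]` and small transfer `G·|p_{x−y}|_𝕋 ≤ Λ(t)/6`, the literal `hP` sum with the
member weight `Φ_j(t) = s_{n+1,j} + (w_{Λₙ₊₁} − w_{Λ(t)})` equals the same sum with `Φ_{n+2}(t)`: the difference is the `D`-line row of the pair `(j, n+2)`, every
term of which has a vanishing line factor (`direct_DLine_factors_eq_zero`). -/
theorem klrf_direct_sum_member_eq_near {R : RenConsts} (hR : ∀ j, 0 ≤ R.Gfr j) {U : ℝ} {N : ℕ} (hK : FrameOK R U N μ K) (n : ℕ) {j : ℕ}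
    (hj : n + 2 ≤ j) {t : ℝ} (ht : t ∈ Icc (0 : ℝ) 1) {x y : TorusSite 2 L}
    (hq : (4 + 8 / 3 * R.Gfr 1 * U ^ 2) * klTorusNorm L (x - y) ≤ (klScale klE0 n + t * (klScale klE0 (n + 1) - klScale klE0 n)) / 6)
    (Φ : ℕ → ℝ → FreqMomentum L M → ℝ) (hΦ : Φ = fun j t k => (softSymbolCompl L M β μ K (n + 1) j) k + (hubbardCutoffWeightCT L M β μ K (klScale klE0 (n + 1)) k -
            hubbardCutoffWeightCT L M β μ K (klScale klE0 n + t * (klScale klE0 (n + 1) - klScale klE0 n)) k))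
    (Wd : ℝ → FreqMomentum L M → ℝ) (hWd : Wd = fun t k => deriv (fun Λ' : ℝ => hubbardCutoffWeightCT L M β μ K Λ' k) (klScale klE0 n + t * (klScale klE0 (n + 1) - klScale klE0 n)))
    (X : FreqMomentum L M → Fin 2 → FreqMomentum L M → ℂ) :
    (∑ p : FreqMomentum L M, ∑ σ : Fin 2, ∑ p' : FreqMomentum L M,
        if matsubaraInt M p'.1 + matsubaraInt M (omega0 M) = matsubaraInt M p.1 + matsubaraInt M (omega0 M) ∧ p'.2 = p.2 + x - y then
          ((((((Φ j t p) : ℝ) : ℂ) * (((β * (L : ℝ) ^ 2 : ℝ) : ℂ) * propCT L M β μ K p)) * ((((Wd t p') : ℝ) : ℂ) * (((β * (L : ℝ) ^ 2 : ℝ) : ℂ) * propCT L M β μ K p'))) +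
              (((((Wd t p) : ℝ) : ℂ) * (((β * (L : ℝ) ^ 2 : ℝ) : ℂ) * propCT L M β μ K p)) * ((((Φ j t p') : ℝ) : ℂ) * (((β * (L : ℝ) ^ 2 : ℝ) : ℂ) * propCT L M β μ K p')))) *
            X p σ p'
        else 0) =
      ∑ p : FreqMomentum L M, ∑ σ : Fin 2, ∑ p' : FreqMomentum L M,
        if matsubaraInt M p'.1 + matsubaraInt M (omega0 M) = matsubaraInt M p.1 + matsubaraInt M (omega0 M) ∧ p'.2 = p.2 + x - y then
          ((((((Φ (n + 2) t p) : ℝ) : ℂ) * (((β * (L : ℝ) ^ 2 : ℝ) : ℂ) * propCT L M β μ K p)) * ((((Wd t p') : ℝ) : ℂ) * (((β * (L : ℝ) ^ 2 : ℝ) : ℂ) * propCT L M β μ K p'))) +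
              (((((Wd t p) : ℝ) : ℂ) * (((β * (L : ℝ) ^ 2 : ℝ) : ℂ) * propCT L M β μ K p)) * ((((Φ (n + 2) t p') : ℝ) : ℂ) * (((β * (L : ℝ) ^ 2 : ℝ) : ℂ) * propCT L M β μ K p')))) *
            X p σ p'
        else 0 := by
  rw [← sub_eq_zero, ← Finset.sum_sub_distrib]
  refine Finset.sum_eq_zero fun p _ => ?_
  rw [← Finset.sum_sub_distrib]
  refine Finset.sum_eq_zero fun σ _ => ?_
  rw [← Finset.sum_sub_distrib]
  refine Finset.sum_eq_zero fun p' _ => ?_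
  split_ifs with hc
  · obtain ⟨hω, hk⟩ := hc
    have hω' : matsubaraInt M p'.1 = matsubaraInt M p.1 := by linarith
    obtain ⟨h1, h2⟩ := direct_DLine_factors_eq_zero β μ K hR hK n le_rfl hj ht hq hω' hk
    -- the member weights differ by the `D`-line of the pair `(j, n+2)`
    have hdiff : ∀ k : FreqMomentum L M,
        Φ j t k = Φ (n + 2) t k + (softSymbolCompl L M β μ K (n + 1) j k - softSymbolCompl L M β μ K (n + 1) (n + 2) k) := by
      intro k; simp only [hΦ]; ring
    have hW : ∀ k : FreqMomentum L M,
        Wd t k = deriv (fun Λ' : ℝ => hubbardCutoffWeightCT L M β μ K Λ' k) (klScale klE0 n + t * (klScale klE0 (n + 1) - klScale klE0 n)) := by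
      intro k; simp only [hWd]
    rw [← hW p'] at h1
    rw [← hW p] at h2
    have h1c := congrArg (fun r : ℝ => (r : ℂ)) h1
    have h2c := congrArg (fun r : ℝ => (r : ℂ)) h2
    push_cast at h1c h2c
    rw [sub_eq_zero, hdiff p, hdiff p']
    push_cast
    linear_combination ((β : ℂ) ^ 2 * (L : ℂ) ^ 4 * propCT L M β μ K p * propCT L M β μ K p' * X p σ p') * h1c +
      ((β : ℂ) ^ 2 * (L : ℂ) ^ 4 * propCT L M β μ K p * propCT L M β μ K p' * X p σ p') * h2c
  · simp

end Summit.HubbardSuperconductivity.HubbardSuperconductivity.Theorems.KLRegimeSplit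

end
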